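import Summits.QuantumFields.YangMills.Theorems.UnitScaleTiltProp7SectET3NormH1Pin
import Literature.MathematicalPhysics.QuantumFieldTheory.Balaban1983to89.B6SectAWholeTorusBridge
import HarnessLib

/-!
# Route `UnitScaleTilt`, crux «MinimiserStabilityRegPr» (stmt-QuantumFields-19200, v10 stub EX, route (α), node N06(d = 3)) — the `norm_H₁` ∕ `norm_G` pins AT THE MEMBER:
# **EVERY INDEX BOND OF THE T³ MEMBER OF RECORD SITS AT THE LEVEL `K − n` AND HAS SCALE LENGTH `Lʲη = 1`** (`geo9K (memberIdx …)`: the padded pure-small-field chart,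
# `c_f = L^{K−n}`), so the spare exponent `s` of ✓ `Prop7SectET3NormH1` is immaterial there and the (115) weight comparisons of ✓ `Prop7SectET3NormH1Pin` are `1 ≤ 1`

Cell `ym3-torus` (HUMAN RULING D-0037, YM ladder rung R3 — NOT the Clay problem), width seat ym-ust-20520-w1 g4 (offer (o-5) of the seat's PROGRESS 3).  Count-neutral helper
(`--supports stmt-QuantumFields-19200 --as helper`); registry untouched; THEOREMS ONLY (0 `def`, 0 `sorry`); NOTHING of [Balaban1985BackgroundPropagators] is asserted.

THE PRINT ∕ THE TREE.  [Balaban1984PropagatorsII] p. 224: *«we admit the case when some domains Ω_j are equal to T_η»* — with ALL `Ω_j = T` the index set `𝔅 = ⋃_j Λ_j` has `Λ_j = ∅`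
for `j < k` and `Λ_k = T^{(k)}` (`B6SectADomainsV1.Domains.whole`, `B6SectAWholeTorusBridge.lamBond_whole_iff`); the T³ member of record `Prop7SectET3Members.memberIdx` is that family
on the member's torus at `k = K − n`, PADDED to index height `K − n + 1` with the SAME `Ω_j` (`Prop7SectET3Members.sameOm_memberIdx`) and band unit `c_f = L^{K−n}` (`memberIdx_cf`);
the k-level geometry reads `Lʲη := L^{j(b)}∕|c_f|` (`B6KLevelCensusIndexV1.len_eq`, `B9GeoNormsKLevelV1.geo9K_len_kGeo`).  [Balaban1985Variational] p. 300: *«we assume that j = k»*,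
`Lᵏη = 1` — the one-level (115) weights of the route's `Space115 L (L⁻¹)^{K−n} (fun _ ↦ K − n) …` (`Prop7CminOfP6T3Pd`).

WHAT IS PROVED (ns `…Theorems.Prop7SectET3MemberLen`).
* `lvl_memberIdx_eq` — every index bond `y` of `geo9K (memberIdx …)` has level `K − n`; ★ `geo9K_len_memberIdx` — `(geo9K (memberIdx …)).len y = 1`; `geo9K_len_rpow_memberIdx` (`len y ^ s = 1`),
  `geo9K_len_rpow_memberIdx_le` (`len y ^ s ≤ 1`: the `hls` row of ✓ `normH_of_thm312Printed` ∕ `normH₁_row_of_t312_classTransfer` HOLDS AT THE MEMBER for every `s`).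
* `levWeight_memberT3_eq_one` — the route's (115) weight `((L^{K−n})·(L⁻¹)^{K−n})^p = 1` at the member's one level; ★ `levWeight_memberT3_le_len_rpow` — hence the weight comparisons
  `hw0`∕`hw1` (`hw`) of ✓ `Prop7SectET3NormH1Pin.jetPins_of_fibrewise` ∕ `weightedPin_of_fibrewise` hold AT THE MEMBER as `1 ≤ 1`, whatever the attaching maps `σ₀`, `σ₁`.
So at the member of record the `norm_H₁` pin is EXACTLY fibrewise domination by the (3.133) entries (`0 ≤ e`), nothing else.
HONEST SCOPE: index bookkeeping ([folklore] over the tree's definitions); no estimate; the family-wide `hls` (all of `KIdx 2 ℓ hd3 hL 1 1`, arbitrary `c_f`) is NOT claimed — off the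
members take `s = 0`; N06(d = 3) NOT discharged; nothing here claims EX, the crux, V3∕R3, d = 4 or the mass gap; YM₃ on T³ is ladder rung R3, not the Clay problem.

References: T. Bałaban, CMP 96 (1984) 223–250 [Balaban1984PropagatorsII] ((2.1)–(2.4) p.224); CMP 102 (1985) 277–309 [Balaban1985Variational] (p.286, (115) p.294, p.300); CMP 99 (1985)
389–434 [Balaban1985BackgroundPropagators] ((3.41) p.397).
-/

set_option autoImplicit false

noncomputable section

namespace Summit.QuantumFields.YangMills.Theorems.Prop7SectET3MemberLen

open Literature.MathematicalPhysics.QuantumFieldTheory.Balaban1983to89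
open Literature.MathematicalPhysics.QuantumFieldTheory.Balaban1983to89.B6KLevelCensusIndexV1 (KIdx kGeo len_eq)
open Literature.MathematicalPhysics.QuantumFieldTheory.Balaban1983to89.B6GlobalChartV1 (PV domT)
open Literature.MathematicalPhysics.QuantumFieldTheory.Balaban1983to89.B6Ineq2142KLevelV1 (lvl)
open Literature.MathematicalPhysics.QuantumFieldTheory.Balaban1983to89.B6SectAWholeTorusBridge (lamBond_whole_iff)
open Literature.MathematicalPhysics.QuantumFieldTheory.Balaban1983to89.B9GeoNormsKLevelV1 (geo9K geo9K_len_kGeo)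
open Literature.MathematicalPhysics.QuantumFieldTheory.Balaban1983to89.B11Eq115Space (levWeight levWeight_apply)
open Summit.QuantumFields.YangMills.Theorems.Prop7SectET3Members (hd3 hkw memberIdx memberIdx_cf sameOm_memberIdx)

variable {ℓ : ℕ} {hL : Odd (ℓ + 1) ∧ 1 < ℓ + 1}

/-- **Every index bond of the member sits at the level `K − n`**: the member's `Ω_j` are the all-torus family's (`sameOm_memberIdx`), whose `Λ_j` is empty unless `j = K − n`
(`lamBond_whole_iff`). [cite: Balaban1984PropagatorsII, (2.3) p.224] -/
theorem lvl_memberIdx_eq (hℓ : 4 ≤ ℓ) (m : ℕ) (hm : 1 ≤ m) (n K a' R : ℕ) (hk1 : 1 ≤ K - n) (hsize : a' + 3 ≤ m + n) (hM8 : 8 ≤ (ℓ + 1) ^ a')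
    (hR2 : 2 * (ℓ + 1) ^ 2 ≤ R) (y : (geo9K (memberIdx ℓ hL hℓ m hm n K a' R hk1 hsize hM8 hR2)).Site) :
    lvl (memberIdx ℓ hL hℓ m hm n K a' R hk1 hsize hM8 hR2).hN (memberIdx ℓ hL hℓ m hm n K a' R hk1 hsize hM8 hR2).D
      (memberIdx ℓ hL hℓ m hm n K a' R hk1 hsize hM8 hR2).hk y = K - n :=
  (lamBond_whole_iff (hkw ℓ hL m n K) y.1.2).1 (((sameOm_memberIdx ℓ hL hℓ m hm n K a' R hk1 hsize hM8 hR2).lamBond_iff y.1.2).1 y.2)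

/-- ★ **`Lʲη = 1` ON EVERY INDEX BOND OF THE MEMBER**: `len y = L^{j(y)}∕|c_f| = L^{K−n}∕L^{K−n} = 1`. [cite: Balaban1984PropagatorsII, (2.1) p.224; Balaban1985Variational, p.300] -/
theorem geo9K_len_memberIdx (hℓ : 4 ≤ ℓ) (m : ℕ) (hm : 1 ≤ m) (n K a' R : ℕ) (hk1 : 1 ≤ K - n) (hsize : a' + 3 ≤ m + n) (hM8 : 8 ≤ (ℓ + 1) ^ a')
    (hR2 : 2 * (ℓ + 1) ^ 2 ≤ R) (y : (geo9K (memberIdx ℓ hL hℓ m hm n K a' R hk1 hsize hM8 hR2)).Site) :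
    (geo9K (memberIdx ℓ hL hℓ m hm n K a' R hk1 hsize hM8 hR2)).len y = 1 := by
  rw [geo9K_len_kGeo, len_eq, lvl_memberIdx_eq, memberIdx_cf, abs_of_pos (by positivity)]
  exact div_self (pow_ne_zero _ (by exact_mod_cast Nat.succ_ne_zero ℓ))

/-- `(Lʲη)^s = 1` on the member's index bonds, for every real exponent `s`. [cite: Balaban1985Variational, p.300 (bookkeeping)] -/
theorem geo9K_len_rpow_memberIdx (hℓ : 4 ≤ ℓ) (m : ℕ) (hm : 1 ≤ m) (n K a' R : ℕ) (hk1 : 1 ≤ K - n) (hsize : a' + 3 ≤ m + n) (hM8 : 8 ≤ (ℓ + 1) ^ a')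
    (hR2 : 2 * (ℓ + 1) ^ 2 ≤ R) (s : ℝ) (y : (geo9K (memberIdx ℓ hL hℓ m hm n K a' R hk1 hsize hM8 hR2)).Site) :
    (geo9K (memberIdx ℓ hL hℓ m hm n K a' R hk1 hsize hM8 hR2)).len y ^ s = 1 := by
  rw [geo9K_len_memberIdx, Real.one_rpow]

/-- **The `hls` row of `Prop7SectET3NormH1` AT THE MEMBER, every `s`**: `(Lʲη)^s ≤ 1`. [cite: Balaban1985Variational, p.300 (bookkeeping)] -/
theorem geo9K_len_rpow_memberIdx_le (hℓ : 4 ≤ ℓ) (m : ℕ) (hm : 1 ≤ m) (n K a' R : ℕ) (hk1 : 1 ≤ K - n) (hsize : a' + 3 ≤ m + n) (hM8 : 8 ≤ (ℓ + 1) ^ a')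
    (hR2 : 2 * (ℓ + 1) ^ 2 ≤ R) (s : ℝ) (y : (geo9K (memberIdx ℓ hL hℓ m hm n K a' R hk1 hsize hM8 hR2)).Site) :
    (geo9K (memberIdx ℓ hL hℓ m hm n K a' R hk1 hsize hM8 hR2)).len y ^ s ≤ 1 :=
  (geo9K_len_rpow_memberIdx hℓ m hm n K a' R hk1 hsize hM8 hR2 s y).le

/-- **The route's one-level (115) weight is `1`**: `((L^{K−n})·(L⁻¹)^{K−n})^p = 1` (print p. 300 «we assume that j = k», `Lᵏη = 1`). [cite: Balaban1985Variational, p.300, (115) p.294] -/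
theorem levWeight_memberT3_eq_one {ι : Type*} (k p : ℕ) (x : ι) :
    levWeight (((ℓ + 1 : ℕ) : ℝ)) ((((ℓ + 1 : ℕ) : ℝ))⁻¹ ^ k) (fun _ : ι => k) p x = 1 := by
  have hL0 : (((ℓ + 1 : ℕ) : ℝ)) ≠ 0 := by exact_mod_cast Nat.succ_ne_zero ℓ
  rw [levWeight_apply, ← mul_pow, mul_inv_cancel₀ hL0, one_pow, one_pow]

/-- ★ **THE (115) WEIGHT COMPARISONS `hw0`∕`hw1` OF `jetPins_of_fibrewise` AT THE MEMBER**: for ANY attaching map `σ` from output points to the member's index bonds and any exponent,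
`(route weight at x) ≤ (Lʲη)(σ x)^p` reads `1 ≤ 1`. [cite: Balaban1985Variational, (115) p.294, p.300] -/
theorem levWeight_memberT3_le_len_rpow (hℓ : 4 ≤ ℓ) (m : ℕ) (hm : 1 ≤ m) (n K a' R : ℕ) (hk1 : 1 ≤ K - n) (hsize : a' + 3 ≤ m + n) (hM8 : 8 ≤ (ℓ + 1) ^ a')
    (hR2 : 2 * (ℓ + 1) ^ 2 ≤ R) {ι : Type*} (σ : ι → (geo9K (memberIdx ℓ hL hℓ m hm n K a' R hk1 hsize hM8 hR2)).Site) (p : ℕ) (q : ℝ) (x : ι) :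
    levWeight (((ℓ + 1 : ℕ) : ℝ)) ((((ℓ + 1 : ℕ) : ℝ))⁻¹ ^ (K - n)) (fun _ : ι => K - n) p x ≤
      (geo9K (memberIdx ℓ hL hℓ m hm n K a' R hk1 hsize hM8 hR2)).len (σ x) ^ q := by
  rw [levWeight_memberT3_eq_one, geo9K_len_rpow_memberIdx]

end Summit.QuantumFields.YangMills.Theorems.Prop7SectET3MemberLen

end
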